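/-
Copyright (c) 2026 the pub-hodgecm-mathlib formalisation cell (harness21).  Prover seat hodgecm-mathlib-F0P3b-p01 (g16): line LH3 «E3 ASSEMBLY» (closer stub `stub_N9`),
RULING #13 brick (A5) THE ASSEMBLY, part 2 = the head (LH3-plan (g3) 2026-09-02T09:57:12Z; spec `F0/P3/F0P3b-p01/g16/SPEC-E3-assembly.v1.md` §4).
-/
import Literature.NumberTheory.Rogawski1990.ArchOrbFamGUnfoldedModel            -- ★ (A5) part 1 p851098 (this seat): `orbFamG_eq_unfoldedModel_of_regG`, `exists_map_cosetCongr_eq_smul_map_of_frame`, `integral_prod_eq_integral_swap_descConj`, §0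
import Literature.NumberTheory.Rogawski1990.ArchOrbFamGSmoothModel              -- ★ (A4) p850939∕p851054 (LH5-p02 (g3∕g4)): `contDiffOn_smoothModel_inRegG`
import Literature.NumberTheory.Rogawski1990.ArchCentralDescentAssemblyKit       -- ★ p842630: `isMulRightInvariant_of_isHaarMeasure_archLocal_diagonal_of_im_eq_zero` (unimodularity of `U(α)_w`)
import Literature.NumberTheory.Automorphic.ArchProductHaarReading               -- ★ `exists_isHaarMeasure_eq_map_archPiEquivCM_symm_pi`
import Literature.NumberTheory.Automorphic.ArchTorusOrbitalFubiniSmooth          -- ★ `coe_archPiEquivCM_symm_apply`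
import HarnessLib

/-!
# (A5), part 2 — CLAUSE (I₂) OF LETTER L1 FOR THE GENUINE FAMILY: `orbFamGExt L α ν′ a′ S′` is `C^∞` on Bouaziz's `T_{in-reg}` `InRegG (slotSign L α) S′`
# (Varadarajan 1977 I §1.12; Bouaziz 1994 §3.1 (I₂); Shelstad 1979 §4; Rogawski 1990 §4.9, §8.2–8.3)

Topic `NumberTheory/Rogawski1990`; namespace `Literature.NumberTheory.Rogawski1990`.  THEOREMS ONLY (no `def`, no `instance`, no notation, no `sorry`).  Cell `pub/hodgecm-mathlib`,
crux H413 (`stmt-HodgeConjecture-24833`), F0∕P3c line LH3 (closer stub `stub_N9`), letter L1 `HcOrbitalFamiliesStatement`, clause (I₂); LH3-plan (g3) RULING #13 (2026-09-02T09:57:12Z)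
«GLOBAL PARABOLIC DESCENT AT THE SPLIT PLACES» (§4 of `F0/P3/F0P3b-p01/g16/SPEC-E3-assembly.v1.md`), brick (A5) = the assembly of ★ (A1) `ArchChartOrbGSplitCompactProduct` (LH3-p02),
★ (A2) `ArchU21SplitPlaceTransport` (LH10-p01), ★ (A3) `ArchU21SplitOrbitNormalisedPi` (LH1-p01), ★ (A4) `ArchOrbFamGSmoothModel` (LH5-p02) and part 1 `ArchOrbFamGUnfoldedModel` (this seat).
Count-neutral: HC_CM stays proved only modulo its printed citations (2 remaining: hLiu418 = `stmt-HodgeConjecture-24832`, h413 = `stmt-HodgeConjecture-24833`) until rung 0 closes.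

THE THEOREM (`contDiffOn_orbFamGExt_inRegG`).  Diagonal house frame `diag α` (`α_i ≠ 0`, `σ_w α_i` real at every complex place), admissible `S′ ⊆ splitChartPlaces`, ANY Haar measure
`ν′` on `G′_∞`, ANY `a′ ∈ C_c^∞(G′_∞)` (★ `ArchSmooth`): **the wall-extended normalised orbital-integral family `orbFamGExt L α ν′ a′ S′` is `C^∞` on ALL of `InRegG (slotSign L α) S′`**
— across the real walls `x_w = 0` (`w ∈ S′`), the scalar split points, the compact walls and every corner.  PROOF = the smooth-MODEL principle `contDiffOn_orbFamGExt_inRegG_of_model`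
(§3; ★ glue `contDiffOn_hcExtendG_of_contDiffOn`): on the dense `G`-regular set the raw member `orbFamG` EQUALS (part 1, (A5a) `orbFamG_eq_unfoldedModel_of_regG` + the swap
`integral_prod_eq_integral_swap_descConj`) the model `H S′ c = pref(c) · ∫_{(G_c⧸M_c) × Π_{S′}(K×N)} a′(ρ(y γ_c(c) y⁻¹, (k_w τ(0,φ_w,θ_w) τ(x_w∕2,0,0) n_w τ(x_w∕2,0,0) k_w⁻¹)_w))`
of ★ (A4) `contDiffOn_smoothModel_inRegG`, which is `C^∞` on `InRegG`; the (A4) binders are discharged here: the product reading of `ν′` (★ `exists_isHaarMeasure_eq_map_archPiEquivCM_symm_pi`,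
unimodularity ★ `isMulRightInvariant_of_isHaarMeasure_archLocal_diagonal_of_im_eq_zero`), the torus Haar measures ★ `chartHaarGLoc` and ★ `exists_haar_map_subgroupPiCoords_eq_pi`,
the maximal compact ★ `exists_isCompact_subgroup_unitary_mul_borelU`, the boost torus ★ `exists_torusU_boostEig_family`, the split frames ★ `exists_continuousMulEquiv_archLocal_splitChart_torusU`
(conjugations by fixed `T_w ∈ GL₃(ℂ)`), the Iwasawa constants (part 1 §1), the recombination homeomorphism `ρ` (§1: `exists_recombineHomeomorph`, proper by
`exists_isCompact_prod_superset_preimage`) and its LINEAR ambient reading `Λ` (§2: `exists_contDiff_recombineMatrix`, ★ `coe_archPiEquivCM_symm_apply`).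

References: V. S. Varadarajan, *Harmonic Analysis on Real Reductive Groups*, LNM 576 (1977), Part I §1.12 [Varadarajan1977]; A. Bouaziz, *Intégrales orbitales sur les algèbres
de Lie réductives*, Invent. Math. 115 (1994), §3.1 (I₂) p. 579 [Bouaziz1994IntegralesOrbitales]; D. Shelstad, *Characters and inner forms of a quasi-split group over ℝ*,
Compositio Math. 39 (1979), §4 pp. 22–24 [Shelstad1979]; J. Rogawski, *Automorphic Representations of Unitary Groups in Three Variables* (1990), §4.9, §8.2–8.3 [Rogawski1990];
A. Borel, H. Jacquet, *Automorphic forms and automorphic representations*, Corvallis I (1979), §4.1 [BorelJacquet1979].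
-/

set_option autoImplicit false

noncomputable section

open MeasureTheory MeasureTheory.Measure Set NumberField NumberField.InfinitePlace NumberField.mixedEmbedding Complex Topology
open Literature.MeasureTheory.Group Literature.NumberTheory.Automorphic Literature.NumberTheory.Automorphic.UnitaryGroup Literature.NumberTheory.Automorphic.ArchCartan
open scoped ContDiff Classical ENNReal NNReal MatrixGroups

namespace Literature.NumberTheory.Rogawski1990

/-! ## §1 The RECOMBINATION homeomorphism «compact-place coordinates × standardised split-place coordinates ≃ₜ G′_∞» and its properness ((A4)'s binders `ρ`, `hρK`) -/

section Recombine

variable {W : Type*} {U : W → Type*} [∀ w, TopologicalSpace (U w)] (p : W → Prop) [DecidablePred p]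
  {V : {w // p w} → Type*} [∀ w, TopologicalSpace (V w)] {G : Type*} [TopologicalSpace G]

/-- **The recombination homeomorphism** `(Π_{¬p} U_w) × (Π_{p} V_w) ≃ₜ G` (existence, no definition): undo the per-index homeomorphisms `φ_w : U_w ≃ₜ V_w` on the
`p`-indices, merge the two index halves (Mathlib `Homeomorph.piEquivPiSubtypeProd`) and pull back along `e : G ≃ₜ Π_w U_w` — the binder `ρ` of the (A4) smooth model ((A5) takes
`p := (· ∈ S′)`, `φ_w` = ★ (e3-5), `e` = ★ `archPiEquivCM`), with its action on elements `ρ (g, v) = e⁻¹ (w ↦ if p w then φ_w⁻¹ (v w) else g w)`. [cite: BorelJacquet1979, §4.1] -/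
theorem exists_recombineHomeomorph (e : G ≃ₜ (∀ w, U w)) (φ : ∀ w : {w // p w}, U w ≃ₜ V w) :
    ∃ ρ : ((∀ w : {w // ¬p w}, U w) × (∀ w : {w // p w}, V w)) ≃ₜ G,
      ∀ (g : ∀ w : {w // ¬p w}, U w) (v : ∀ w : {w // p w}, V w), ρ (g, v) = e.symm (fun w => if h : p w then (φ ⟨w, h⟩).symm (v ⟨w, h⟩) else g ⟨w, h⟩) :=
  ⟨(Homeomorph.prodComm _ _).trans
    (((Homeomorph.piCongrRight fun w => (φ w).symm).prodCongr (Homeomorph.refl _)).trans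
      ((Homeomorph.piEquivPiSubtypeProd p U).symm.trans e.symm)), fun _ _ => rfl⟩

/-- **Properness of the recombination** (the binder `hρK` of (A4)): the preimage of a compact set under a homeomorphism `X × Y ≃ₜ Z` sits in a product of compacts.
[cite: BorelJacquet1979, §4.1] -/
theorem exists_isCompact_prod_superset_preimage {X Y Z : Type*} [TopologicalSpace X] [TopologicalSpace Y] [TopologicalSpace Z] (ρ : X × Y ≃ₜ Z)
    {S : Set Z} (hS : IsCompact S) : ∃ A : Set X, ∃ B : Set Y, IsCompact A ∧ IsCompact B ∧ ρ ⁻¹' S ⊆ A ×ˢ B := by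
  have hK : IsCompact (ρ ⁻¹' S) := ρ.isCompact_preimage.2 hS
  exact ⟨Prod.fst '' (ρ ⁻¹' S), Prod.snd '' (ρ ⁻¹' S), hK.image continuous_fst, hK.image continuous_snd,
    fun x hx => ⟨⟨x, hx, rfl⟩, ⟨x, hx, rfl⟩⟩⟩

end Recombine

/-! ## §2 The ambient (linear, hence smooth) reading `Λ` of the recombination -/

section RecombineMatrix

open scoped Matrix.Norms.Operator

variable (L : Type) [Field L] [NumberField L] (S' : Finset {w : InfinitePlace L // IsComplex w})

/-- **The recombination is LINEAR in the ambient matrices, hence `C^∞`** (the binders `Λ`, `hΛ` of ★ (A4) `contDiffOn_smoothModel_inRegG`): for fixed conjugating matrices `P_w, Q_w`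
(`w ∈ S′`), `(m_g, m_u) ↦ Matrix.of (i, j) ↦ (0, w ↦ [w ∈ S′] (P_w m_u(w) Q_w)_{ij} ∣ [w ∉ S′] m_g(w)_{ij})` into `M₃(L ⊗ ℝ)` is a (finite-dimensional) ℝ-linear map.
[cite: BorelJacquet1979, §4.1] -/
theorem exists_contDiff_recombineMatrix (P Q : ↥S' → Matrix (Fin 3) (Fin 3) ℂ) :
    ∃ Λ : (({w : {w : InfinitePlace L // IsComplex w} // w ∉ S'} → Matrix (Fin 3) (Fin 3) ℂ) × (↥S' → Matrix (Fin 3) (Fin 3) ℂ)) →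
        Matrix (Fin 3) (Fin 3) (mixedSpace L),
      ContDiff ℝ ∞ Λ ∧ ∀ mg mu, Λ (mg, mu) = Matrix.of fun i j => ((0 : {w : InfinitePlace L // IsReal w} → ℝ),
        fun w : {w : InfinitePlace L // IsComplex w} => if h : w ∈ S' then (P ⟨w, h⟩ * mu ⟨w, h⟩ * Q ⟨w, h⟩) i j else mg ⟨w, h⟩ i j) := by
  classical
  let Λ : (({w : {w : InfinitePlace L // IsComplex w} // w ∉ S'} → Matrix (Fin 3) (Fin 3) ℂ) × (↥S' → Matrix (Fin 3) (Fin 3) ℂ)) →ₗ[ℝ]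
      Matrix (Fin 3) (Fin 3) (mixedSpace L) :=
    { toFun := fun p => Matrix.of fun i j => ((0 : {w : InfinitePlace L // IsReal w} → ℝ),
        fun w : {w : InfinitePlace L // IsComplex w} => if h : w ∈ S' then (P ⟨w, h⟩ * p.2 ⟨w, h⟩ * Q ⟨w, h⟩) i j else p.1 ⟨w, h⟩ i j)
      map_add' := fun p q => by
        ext i j
        · simp
        · rename_i w
          simp only [Prod.fst_add, Prod.snd_add, Matrix.of_apply, Matrix.add_apply, Pi.add_apply]
          split_ifs with h
          · rw [Matrix.mul_add, Matrix.add_mul, Matrix.add_apply]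
          · rfl
      map_smul' := fun c p => by
        ext i j
        · simp
        · rename_i w
          simp only [Prod.smul_fst, Prod.smul_snd, Matrix.of_apply, Matrix.smul_apply, RingHom.id_apply, Pi.smul_apply, Prod.smul_snd]
          split_ifs with h
          · rw [Matrix.mul_smul, Matrix.smul_mul, Matrix.smul_apply]
          · rfl }
  refine ⟨Λ, (LinearMap.toContinuousLinearMap Λ).contDiff, fun mg mu => rfl⟩

end RecombineMatrix

/-! ## §3 The smooth-MODEL principle ((A5) glue in binder form) -/

section Model

variable (L : Type) [Field L] [NumberField L] [IsCMField L] (α : Fin 3 → L)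
  [MeasurableSpace ↥(arch (↥(maximalRealSubfield L)) L (IsCMField.complexConj L) 3 (Matrix.diagonal α))] [BorelSpace ↥(arch (↥(maximalRealSubfield L)) L (IsCMField.complexConj L) 3 (Matrix.diagonal α))]
  (ν' : Measure ↥(arch (↥(maximalRealSubfield L)) L (IsCMField.complexConj L) 3 (Matrix.diagonal α))) [IsFiniteMeasureOnCompacts ν'] [ν'.IsMulRightInvariant]
  (a' : ↥(arch (↥(maximalRealSubfield L)) L (IsCMField.complexConj L) 3 (Matrix.diagonal α)) → ℂ) (S' : Finset {w : InfinitePlace L // IsComplex w})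

/-- **(A5) GLUE, BINDER FORM: a smooth MODEL of the raw member on `InRegG` makes the wall-extended member smooth on `InRegG`.**  If `H` is `C^∞` on the open ★ `InRegG (slotSign L α) S′`
and `orbFamG L α ν′ a′ S′ = H` on ★ `RegG S′`, then `ContDiffOn ℝ ∞ (orbFamGExt L α ν′ a′ S′) (InRegG (slotSign L α) S′)` (★ glue `contDiffOn_hcExtendG_of_contDiffOn` at `U := InRegG`; the model is
what the §4 assembly (A1)–(A4) builds: the `|D_G|^{1∕2}`-unfolded split places times the compact-place quotient integral). [cite: Varadarajan1977, I §1.12] [cite: Bouaziz1994IntegralesOrbitales, §3.1 (I₂) p. 579]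
[cite: Shelstad1979, §4 p. 24] -/
theorem contDiffOn_orbFamGExt_inRegG_of_model {H : ({w : InfinitePlace L // IsComplex w} → Fin 3 → ℝ) → ℂ}
    (hH : ContDiffOn ℝ ∞ H (InRegG (slotSign L α) S')) (hEq : EqOn (orbFamG L α ν' a' S') H (RegG S')) :
    ContDiffOn ℝ ∞ (orbFamGExt L α ν' a' S') (InRegG (slotSign L α) S') := by
  have h := contDiffOn_hcExtendG_of_contDiffOn (slotSign L α) S' (orbFamG L α ν' a' S') (isOpen_inRegG (slotSign L α) S') hH (fun c hc => hEq hc.2)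
  rw [Set.inter_self] at h
  rw [orbFamGExt_apply]
  exact h

/-- **(A5) GLUE on a neighbourhood**: the same with the model given only on an open `U` — smoothness of the extended member on `U ∩ InRegG` (the local form the assembly may deliver chart
point by chart point before the global model is typed). [cite: Varadarajan1977, I §1.12] [cite: Bouaziz1994IntegralesOrbitales, §3.1 (I₂) p. 579] -/
theorem contDiffOn_orbFamGExt_inter_inRegG_of_model {U : Set ({w : InfinitePlace L // IsComplex w} → Fin 3 → ℝ)} (hU : IsOpen U)
    {H : ({w : InfinitePlace L // IsComplex w} → Fin 3 → ℝ) → ℂ} (hH : ContDiffOn ℝ ∞ H U) (hEq : EqOn (orbFamG L α ν' a' S') H (U ∩ RegG S')) :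
    ContDiffOn ℝ ∞ (orbFamGExt L α ν' a' S') (U ∩ InRegG (slotSign L α) S') := by
  rw [orbFamGExt_apply]
  exact contDiffOn_hcExtendG_of_contDiffOn (slotSign L α) S' (orbFamG L α ν' a' S') hU hH hEq

end Model

/-! ## §4 THE HEAD: clause (I₂) of letter L1 for the genuine family, hypothesis-free -/

section Head

variable (L : Type) [Field L] [NumberField L] [IsCMField L] (α : Fin 3 → L)
  [MeasurableSpace ↥(arch (↥(maximalRealSubfield L)) L (IsCMField.complexConj L) 3 (Matrix.diagonal α))] [BorelSpace ↥(arch (↥(maximalRealSubfield L)) L (IsCMField.complexConj L) 3 (Matrix.diagonal α))]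
  (ν' : Measure ↥(arch (↥(maximalRealSubfield L)) L (IsCMField.complexConj L) 3 (Matrix.diagonal α))) [ν'.IsHaarMeasure] [ν'.IsMulRightInvariant]
  (S' : Finset {w : InfinitePlace L // IsComplex w})

/-- **CLAUSE (I₂) OF LETTER L1 FOR THE GENUINE FAMILY, HYPOTHESIS-FREE.**  For the diagonal house frame (`hα`, `hreal`), an admissible chart `S′` (`hS′`), any Haar measure `ν′` on
`G′_∞` and any `a′ ∈ C_c^∞(G′_∞)`: **`ContDiffOn ℝ ∞ (orbFamGExt L α ν′ a′ S′) (InRegG (slotSign L α) S′)`** — the wall-extended `|D_G|^{1∕2}`-normalised orbital-integral family is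
`C^∞` on all of Bouaziz's `T_{in-reg}`: across the real walls, at the scalar split points, across the compact walls and at corners of any depth (Harish-Chandra ∕ Varadarajan I §1.12 for
`U(2,1)`; Bouaziz (I₂) «se prolonge en une fonction `C^∞` sur `H_{Ψ-reg}`»; Shelstad §4).  The §4 assembly (A1)–(A5) of RULING #13: `orbFamG = H S′` on `RegG S′` (part 1 + §1–§2 here)
with `H S′` the unfolded model, `C^∞` on `InRegG` by ★ (A4); then the model principle (§3). [cite: Varadarajan1977, I §1.12] [cite: Bouaziz1994IntegralesOrbitales, §3.1 (I₂) p. 579]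
[cite: Shelstad1979, §4 pp. 22–24] [cite: Rogawski1990, §4.9 (4.9.1)–(4.9.2) p. 55; §8.2 p. 122; §8.3 p. 124] -/
theorem contDiffOn_orbFamGExt_inRegG (hα : ∀ i, α i ≠ 0) (hreal : ∀ (w : {w : InfinitePlace L // IsComplex w}) (i : Fin 3), (w.1.embedding (α i)).im = 0)
    (hS' : ∀ w, w ∈ S' → w ∈ splitChartPlaces L α)
    {a' : ↥(arch (↥(maximalRealSubfield L)) L (IsCMField.complexConj L) 3 (Matrix.diagonal α)) → ℂ} (ha' : ArchSmooth L 3 (Matrix.diagonal α) a') :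
    ContDiffOn ℝ ∞ (orbFamGExt L α ν' a' S') (InRegG (slotSign L α) S') := by
  /- (0) Borel structures and topological facts on the local groups, their chart quotients and the compact-place quotient -/
  letI : ∀ w : {w : InfinitePlace L // IsComplex w}, MeasurableSpace ↥(archLocal L 3 (Matrix.diagonal α) w) := fun w => borel _
  haveI : ∀ w : {w : InfinitePlace L // IsComplex w}, BorelSpace ↥(archLocal L 3 (Matrix.diagonal α) w) := fun w => ⟨rfl⟩
  haveI : ∀ w : {w : InfinitePlace L // IsComplex w}, LocallyCompactSpace ↥(archLocal L 3 (Matrix.diagonal α) w) := fun w => locallyCompactSpace_archLocal_three L α w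
  haveI : ∀ w : {w : InfinitePlace L // IsComplex w}, SecondCountableTopology ↥(archLocal L 3 (Matrix.diagonal α) w) := fun w => secondCountableTopology_archLocal_three L α w
  letI : ∀ w : {w : InfinitePlace L // IsComplex w}, MeasurableSpace (↥(archLocal L 3 (Matrix.diagonal α) w) ⧸ chartTorusGLoc L α w S') := fun w => borel _
  haveI : ∀ w : {w : InfinitePlace L // IsComplex w}, BorelSpace (↥(archLocal L 3 (Matrix.diagonal α) w) ⧸ chartTorusGLoc L α w S') := fun w => ⟨rfl⟩
  letI : MeasurableSpace ((∀ w : {w : {w : InfinitePlace L // IsComplex w} // w ∉ S'}, ↥(archLocal L 3 (Matrix.diagonal α) w.1)) ⧸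
      Subgroup.pi Set.univ (fun w : {w : {w : InfinitePlace L // IsComplex w} // w ∉ S'} => chartTorusGLoc L α w.1 S')) := borel _
  haveI : BorelSpace ((∀ w : {w : {w : InfinitePlace L // IsComplex w} // w ∉ S'}, ↥(archLocal L 3 (Matrix.diagonal α) w.1)) ⧸
      Subgroup.pi Set.univ (fun w : {w : {w : InfinitePlace L // IsComplex w} // w ∉ S'} => chartTorusGLoc L α w.1 S')) := ⟨rfl⟩
  /- (1) the product reading of `ν′`; every local factor is right invariant (unimodularity) -/
  obtain ⟨ν'w, hν'w, hν⟩ := exists_isHaarMeasure_eq_map_archPiEquivCM_symm_pi L 3 α ν'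
  haveI : ∀ w, (ν'w w).IsHaarMeasure := hν'w
  haveI : ∀ w, (ν'w w).IsMulRightInvariant := fun w => isMulRightInvariant_of_isHaarMeasure_archLocal_diagonal_of_im_eq_zero L α hα w (hreal w) (ν'w w)
  /- (2) torus Haar measures: the local `chartHaarGLoc`, and `ρ_cpt` on `Π_{w∉S′} T′_w` with these coordinates -/
  haveI : ∀ w : {w : InfinitePlace L // IsComplex w}, (chartHaarGLoc L α w S').IsHaarMeasure := fun w => isHaarMeasure_chartHaarGLoc L α w S'
  haveI : ∀ w : {w : InfinitePlace L // IsComplex w}, (chartHaarGLoc L α w S').IsInvInvariant := fun w => isInvInvariant_chartHaarGLoc L α w S'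
  haveI : ∀ w : {w : InfinitePlace L // IsComplex w}, SigmaFinite (chartHaarGLoc L α w S') := fun w => sigmaFinite_chartHaarGLoc L α w S'
  obtain ⟨ρcpt, hρ1, hρ2, hρ⟩ := exists_haar_map_subgroupPiCoords_eq_pi
    (fun w : {w : {w : InfinitePlace L // IsComplex w} // w ∉ S'} => chartTorusGLoc L α w.1 S') (fun w => isClosed_chartTorusGLoc L α w.1 S')
    (fun w : {w : {w : InfinitePlace L // IsComplex w} // w ∉ S'} => chartHaarGLoc L α w.1 S')
  haveI := hρ1
  haveI := hρ2
  /- (3) the standard split group `U(J₃)(ℂ)`: Borel structures, the maximal compact `K`, Haar measures `κ` on `K` and `μ_N` on `N`, the boost torus family `τ` -/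
  obtain ⟨J, hJ⟩ : ∃ J : Matrix (Fin 3) (Fin 3) ℂ, J = (StdForm.antidiagonal 3).over ℂ := ⟨_, rfl⟩
  letI : MeasurableSpace ↥(unitaryGroupOfForm (starRingEnd ℂ) J) := borel _
  haveI : BorelSpace ↥(unitaryGroupOfForm (starRingEnd ℂ) J) := ⟨rfl⟩
  letI : MeasurableSpace (↥(unitaryGroupOfForm (starRingEnd ℂ) J) ⧸ torusU (starRingEnd ℂ) J) := borel _
  haveI : BorelSpace (↥(unitaryGroupOfForm (starRingEnd ℂ) J) ⧸ torusU (starRingEnd ℂ) J) := ⟨rfl⟩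
  haveI : LocallyCompactSpace ↥(unitaryGroupOfForm (starRingEnd ℂ) J) := locallyCompactSpace_unitaryGroupOfForm_complex J
  haveI : SecondCountableTopology ↥(unitaryGroupOfForm (starRingEnd ℂ) J) := secondCountableTopology_unitaryGroupOfForm_complex J
  obtain ⟨K, hK, -, hKB⟩ := exists_isCompact_subgroup_unitary_mul_borelU hJ
  haveI : CompactSpace ↥K := isCompact_iff_compactSpace.mp hK
  haveI : LocallyCompactSpace ↥K := hK.isClosed.isClosedEmbedding_subtypeVal.locallyCompactSpace
  obtain ⟨κ, hκ⟩ : ∃ κ : Measure ↥K, κ.IsHaarMeasure := ⟨Measure.haar, inferInstance⟩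
  haveI := hκ
  have hN : IsClosed (unipotentU (starRingEnd ℂ) J : Set ↥(unitaryGroupOfForm (starRingEnd ℂ) J)) := LineRing.isClosed_unipotentU _ _
  haveI : LocallyCompactSpace ↥(unipotentU (starRingEnd ℂ) J) := hN.isClosedEmbedding_subtypeVal.locallyCompactSpace
  obtain ⟨μN, hμN⟩ : ∃ μN : Measure ↥(unipotentU (starRingEnd ℂ) J), μN.IsHaarMeasure := ⟨Measure.haar, inferInstance⟩
  haveI := hμN
  obtain ⟨τ, hτT, hτcoe, hτmul, hτd⟩ := exists_torusU_boostEig_family hJ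
  /- (4) the frames `φ_w : U(α)_w ≃ₜ* U(J₃)(ℂ)` at the split places `w ∈ S′`, conjugations by fixed `T_w`, and the Iwasawa constants `C_w` -/
  choose φ hφ hT hφT using fun w : ↥S' => exists_continuousMulEquiv_archLocal_splitChart_torusU L α w.1 hα (hS' _ w.2) hJ
  choose T hT using hT
  have hφT' : ∀ (w : ↥S') (g : ↥(archLocal L 3 (Matrix.diagonal α) w.1)), (φ w).toMulEquiv g ∈ torusU (starRingEnd ℂ) J ↔ g ∈ chartTorusGLoc L α w.1 S' :=
    fun w g => hφT w S' hS' w.2 g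
  have hφd : ∀ (w : ↥S') (cw : Fin 3 → ℝ), glDiagonal 3 ℂ (fun i => Units.mk0 (boostEig cw i) (boostEig_ne_zero cw i)) =
      ((φ w (gprimeBlockAt L α w.1 S' cw) : ↥(unitaryGroupOfForm (starRingEnd ℂ) J)) : GL (Fin 3) ℂ) := fun w cw => (hφ w S' (fun _ => cw) w.2).2.1
  have hC : ∀ w : ↥S', ∃ C : ℝ≥0, 0 < C ∧
      (quotientMeasure (chartTorusGLoc L α w.1 S') (chartHaarGLoc L α w.1 S') (isClosed_chartTorusGLoc L α w.1 S') (ν'w w.1)).map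
          (cosetCongr (φ w).toMulEquiv (chartTorusGLoc L α w.1 S') (torusU (starRingEnd ℂ) J) (hφT' w)) = C • Measure.map
        (fun p : ↥K × ↥(unipotentU (starRingEnd ℂ) J) =>
          (QuotientGroup.mk ((p.1 : ↥(unitaryGroupOfForm (starRingEnd ℂ) J)) * (p.2 : ↥(unitaryGroupOfForm (starRingEnd ℂ) J))) :
            ↥(unitaryGroupOfForm (starRingEnd ℂ) J) ⧸ torusU (starRingEnd ℂ) J))
        (κ.prod μN) := fun w => by
    haveI := smulInvariantMeasure_quotientMeasure (chartTorusGLoc L α w.1 S') (chartHaarGLoc L α w.1 S') (isClosed_chartTorusGLoc L α w.1 S') (ν'w w.1)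
    exact exists_map_cosetCongr_eq_smul_map_of_frame hJ (chartTorusGLoc L α w.1 S') (φ w) (hφT' w) hK hKB κ μN _
      (quotientMeasure_ne_zero (chartTorusGLoc L α w.1 S') (chartHaarGLoc L α w.1 S') (isClosed_chartTorusGLoc L α w.1 S') (ν'w w.1))
  choose C hCpos hμC using hC
  /- (5) (A5a): the unfolded model equals `orbFamG` on `RegG S′` -/
  have hA := fun (c : {w : InfinitePlace L // IsComplex w} → Fin 3 → ℝ) (hc : c ∈ RegG S') =>
    orbFamG_eq_unfoldedModel_of_regG L α S' ν'w ν' hν (fun w => chartHaarGLoc L α w S') ρcpt hρ hJ φ hφT' hφd κ μN hμC τ hτT hτcoe hτmul hτd hα hS' a' ha'.continuous hc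
  /- (6) the recombination homeomorphism `ρ` and its linear ambient reading `Λ` -/
  obtain ⟨ρh, hρh⟩ := exists_recombineHomeomorph (fun w : {w : InfinitePlace L // IsComplex w} => w ∈ S') (archPiEquivCM 3 L (Matrix.diagonal α)).toHomeomorph
    (fun w : ↥S' => (φ w).toHomeomorph)
  obtain ⟨Λ, hΛ, hΛapply⟩ := exists_contDiff_recombineMatrix L S' (fun w : ↥S' => (((T w)⁻¹ : GL (Fin 3) ℂ) : Matrix (Fin 3) (Fin 3) ℂ))
    (fun w : ↥S' => ((T w : GL (Fin 3) ℂ) : Matrix (Fin 3) (Fin 3) ℂ))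
  have hsymm : ∀ (w : ↥S') (v : ↥(unitaryGroupOfForm (starRingEnd ℂ) J)),
      (((φ w).symm v : ↥(archLocal L 3 (Matrix.diagonal α) w.1)) : GL (Fin 3) ℂ) = (T w)⁻¹ * (v : GL (Fin 3) ℂ) * T w := fun w v => by
    have h := hT w ((φ w).symm v)
    rw [ContinuousMulEquiv.apply_symm_apply] at h
    rw [h]
    group
  have hρΛ : ∀ (g : ∀ w : {w : {w : InfinitePlace L // IsComplex w} // w ∉ S'}, ↥(archLocal L 3 (Matrix.diagonal α) w.1)) (u : ↥S' → ↥(unitaryGroupOfForm (starRingEnd ℂ) J)),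
      (((ρh (g, u) : ↥(arch (↥(maximalRealSubfield L)) L (IsCMField.complexConj L) 3 (Matrix.diagonal α))) : GL (Fin 3) (mixedSpace L)) : Matrix (Fin 3) (Fin 3) (mixedSpace L)) =
        Λ (fun i => (((g i : ↥(archLocal L 3 (Matrix.diagonal α) i.1)) : GL (Fin 3) ℂ) : Matrix (Fin 3) (Fin 3) ℂ),
          fun j => (((u j : ↥(unitaryGroupOfForm (starRingEnd ℂ) J)) : GL (Fin 3) ℂ) : Matrix (Fin 3) (Fin 3) ℂ)) := by
    intro g u
    rw [hρh, hΛapply]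
    have e1 : (archPiEquivCM 3 L (Matrix.diagonal α)).toHomeomorph.symm
        (fun w => if h : w ∈ S' then (φ ⟨w, h⟩).toHomeomorph.symm (u ⟨w, h⟩) else g ⟨w, h⟩) =
      (archPiEquivCM 3 L (Matrix.diagonal α)).symm (fun w => if h : w ∈ S' then (φ ⟨w, h⟩).symm (u ⟨w, h⟩) else g ⟨w, h⟩) := rfl
    rw [e1, coe_archPiEquivCM_symm_apply]
    refine Matrix.ext fun i j => Prod.ext rfl (funext fun w => ?_)
    simp only [Matrix.of_apply]
    by_cases h : w ∈ S'
    · rw [dif_pos h, dif_pos h, hsymm, Units.val_mul, Units.val_mul]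
    · rw [dif_neg h, dif_neg h]
  /- (7) the smooth model is `C^∞` on `InRegG` (★ (A4)) -/
  haveI : IsFiniteMeasureOnCompacts (Measure.pi fun _ : ↥S' => κ.prod μN) := inferInstance
  have hpref : ContDiffOn ℝ ∞ (fun c : {w : InfinitePlace L // IsComplex w} → Fin 3 → ℝ =>
      (∏ w ∈ Finset.univ.filter (fun w => w ∉ S'),
          ((1 - (Circle.exp (c w 1 - c w 0) : ℂ)) * (1 - (Circle.exp (c w 2 - c w 0) : ℂ)) * (1 - (Circle.exp (c w 2 - c w 1) : ℂ)))) *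
        (∏ w, ((chartHaarGLoc L α w S' (chartBoxImgGLoc L α w S')).toReal : ℂ)) * ((∏ w : ↥S', (C w : ℝ) : ℝ) : ℂ)) (InRegG (slotSign L α) S') :=
    (((contDiff_prod_cptFactor S').mul contDiff_const).mul contDiff_const).contDiffOn
  have hH := contDiffOn_smoothModel_inRegG L α S' hα hreal hS' (fun w : {w : {w : InfinitePlace L // IsComplex w} // w ∉ S'} => w.1) (fun w => w.2)
    (fun w : ↥S' => w.1)
    (quotientMeasure (Subgroup.pi Set.univ (fun w : {w : {w : InfinitePlace L // IsComplex w} // w ∉ S'} => chartTorusGLoc L α w.1 S')) ρcpt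
      (isClosed_coe_pi _ fun w => isClosed_chartTorusGLoc L α w.1 S')
      (Measure.pi fun w : {w : {w : InfinitePlace L // IsComplex w} // w ∉ S'} => ν'w w.1))
    hJ (fun _ => K) (fun _ => hK) (Measure.pi fun _ : ↥S' => κ.prod μN) τ hτcoe ρh (fun S₀ hS₀ => exists_isCompact_prod_superset_preimage ρh hS₀) Λ hΛ hρΛ ha' _ hpref
  /- (8) the model principle: `orbFamG = H S′` on `RegG S′` (part 1 (A5a), then the swap of part 1 §2 with EVERY argument explicit — no unification against integrals) -/
  refine contDiffOn_orbFamGExt_inRegG_of_model L α ν' a' S' hH fun c hc => (hA c hc).trans (congrArg (HMul.hMul _) ?_)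
  have hswap := integral_prod_eq_integral_swap_descConj
    (fun i : {w : {w : InfinitePlace L // IsComplex w} // w ∉ S'} => gprimeBlock L α i.1 S' c)
    (Subgroup.pi Set.univ (fun i : {w : {w : InfinitePlace L // IsComplex w} // w ∉ S'} => chartTorusGLoc L α i.1 S'))
    (forall_mem_piNotMem_chartTorusGLoc_comm L α S' c)
    (Measure.pi fun _ : ↥S' => κ.prod μN)
    (quotientMeasure (Subgroup.pi Set.univ (fun w : {w : {w : InfinitePlace L // IsComplex w} // w ∉ S'} => chartTorusGLoc L α w.1 S')) ρcpt
      (isClosed_coe_pi _ fun w => isClosed_chartTorusGLoc L α w.1 S')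
      (Measure.pi fun w : {w : {w : InfinitePlace L // IsComplex w} // w ∉ S'} => ν'w w.1))
    a'
    (fun p : (∀ i : {w : {w : InfinitePlace L // IsComplex w} // w ∉ S'}, ↥(archLocal L 3 (Matrix.diagonal α) i.1)) × (↥S' → ↥K × ↥(unipotentU (starRingEnd ℂ) J)) =>
      ρh (p.1, fun j : ↥S' => ((p.2 j).1 : ↥(unitaryGroupOfForm (starRingEnd ℂ) J)) *
        (τ ![0, c j.1 1, c j.1 2] * τ ![c j.1 0 / 2, 0, 0] * ((p.2 j).2 : ↥(unitaryGroupOfForm (starRingEnd ℂ) J)) * τ ![c j.1 0 / 2, 0, 0]) *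
        ((p.2 j).1 : ↥(unitaryGroupOfForm (starRingEnd ℂ) J))⁻¹))
    (fun q : (↥S' → ↥K × ↥(unipotentU (starRingEnd ℂ) J)) ×
        ((∀ w : {w : {w : InfinitePlace L // IsComplex w} // w ∉ S'}, ↥(archLocal L 3 (Matrix.diagonal α) w.1)) ⧸
          Subgroup.pi Set.univ (fun w : {w : {w : InfinitePlace L // IsComplex w} // w ∉ S'} => chartTorusGLoc L α w.1 S')) =>
      a' ((archPiEquivCM 3 L (Matrix.diagonal α)).symm fun w =>
        if h : w ∈ S' then
          (φ ⟨w, h⟩).symm (((q.1 ⟨w, h⟩).1 : ↥(unitaryGroupOfForm (starRingEnd ℂ) J)) *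
            (τ ![0, c w 1, c w 2] * τ ![c w 0 / 2, 0, 0] * ((q.1 ⟨w, h⟩).2 : ↥(unitaryGroupOfForm (starRingEnd ℂ) J)) * τ ![c w 0 / 2, 0, 0]) *
            ((q.1 ⟨w, h⟩).1 : ↥(unitaryGroupOfForm (starRingEnd ℂ) J))⁻¹)
        else
          descConj (fun w : {w : {w : InfinitePlace L // IsComplex w} // w ∉ S'} => gprimeBlock L α w.1 S' c)
            (Subgroup.pi Set.univ (fun w : {w : {w : InfinitePlace L // IsComplex w} // w ∉ S'} => chartTorusGLoc L α w.1 S'))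
            (forall_mem_piNotMem_chartTorusGLoc_comm L α S' c)
            (fun g => (g ⟨w, h⟩ : ↥(archLocal L 3 (Matrix.diagonal α) w))) q.2))
    (fun u g => by
      dsimp only
      rw [hρh]
      rfl)
  exact hswap

end Head

end Literature.NumberTheory.Rogawski1990

end
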